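import Summits.Ventures.HodgeRepro2.T5HermitianIsotropicForm
import Summits.Ventures.HodgeRepro2.T5StarOfInvolution

/-!
# A self-dual lattice exists iff the determinant is a unit times a norm (Tier-5 support, N3)

The N3 record's condition (u3) at a non-split place `v` reads: «`V_v` admits a self-dual
`𝔬_{E_v}`-lattice iff its one-dimensional anisotropic kernel is `(E_v, N_{E_v/F_v})` up to
isometry, i.e. iff `det V_v` has even valuation» (route-2, N3 v0.15 §N3.10.3, after MVW LNM 1291
Ch. 5 Remarque (2)(c)). This file puts the lattice half of that sentence in kernel form for an
isotropic hermitian space of dimension 3 over a quadratic extension `E/F` with `F` the fraction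
field of an integrally closed domain `R₀` and `𝒪_E := integralClosure R₀ E`:

  **a self-dual lattice `Q · 𝒪_E³` exists ⟺ `det H ∈ R₀ˣ · N(E^×)`** (`det H = a · star y · y`),

the middle-entry scaling `diag(1, d, 1)` of the field-level normal form `Pᴴ H P = antidiag(1, u, 1)`
(`T5HermitianIsotropicForm.exists_congruent_J3`) turning `u` into `−a ∈ R₀ˣ` exactly when `u` is a
unit times a norm. At an inert place `R₀ˣ · N(E^×)` is the set of elements of `F^×` of even
valuation (the norm of a unit of `𝒪_E` is a unit of `R₀`, a uniformiser of `F` stays one in `E`),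
which is how the record states (u3); that valuation reading is left to a later file.

* `conjTranspose_diagonal_mul_J3_mul_diagonal`: `diag(1,d,1)ᴴ · antidiag(1,u,1) · diag(1,d,1) =
  antidiag(1, star d · u · d, 1)`.
* `isInteger_det`: the determinant of a matrix with integral entries is integral.
* `exists_algebraMap_unit_eq_of_star_eq_of_isInteger`: a star-fixed element of `E` that is
  integral with integral inverse lies in `R₀ˣ` (`R₀` integrally closed).
* `exists_congruent_J3_unit_of_det_eq_mul_norm` (⇐) and
  `exists_det_eq_mul_norm_of_congruent_integral` (⇒); `exists_congruent_integral_iff_det_eq_mul_norm`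
  (the equivalence) and `exists_dualLattice_eq_iff_det_eq_mul_norm` (with the lattice spelled
  through `T5UnitaryGroupIsometry.dualLattice`).
* `…_quadratic`: the same for the Galois conjugation of a quadratic extension as the star.

Hypotheses: `H` hermitian, `IsUnit H.det`, `(2 : E) ≠ 0`, an isotropic vector for ⇐; the star
fixes `F` pointwise and has `F` as fixed field (true for the Galois conjugation,
`T5StarOfInvolution.star_eq_self_iff_mem_range`). No L-value anywhere (README §8(d): NO).
-/

namespace Summit.Ventures.HodgeRepro2.T5SelfDualLatticeDet

open T5UnitaryGroupIsometry T5HermitianThreeElements T5HermitianIsotropicForm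

section Diagonal

variable {E : Type*} [Field E] [StarRing E]

/-- Conjugating `antidiag(1, u, 1)` by `diag(1, d, 1)` rescales the middle entry by `star d · d`. -/
theorem conjTranspose_diagonal_mul_J3_mul_diagonal (u d : E) :
    (Matrix.diagonal ![1, d, 1]).conjTranspose * J3 u * Matrix.diagonal ![1, d, 1] =
      J3 (star d * u * d) := by
  ext i j
  rw [Matrix.diagonal_conjTranspose, Matrix.mul_diagonal, Matrix.diagonal_mul]
  fin_cases i <;> fin_cases j <;>
    simp [J3, T5AntidiagonalForm.antidiagonalMatrix, Fin.rev, Fin.ext_iff]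

omit [StarRing E] in
/-- `antidiag(1, u, 1) · antidiag(1, u⁻¹, 1) = 1`. -/
theorem J3_mul_J3_inv (u : E) (hu : u ≠ 0) : J3 u * J3 u⁻¹ = 1 := by
  ext i j
  simp only [Matrix.mul_apply, Fin.sum_univ_three, J3, T5AntidiagonalForm.antidiagonalMatrix,
    Matrix.of_apply]
  fin_cases i <;> fin_cases j <;> simp [Fin.rev, Fin.ext_iff, hu]

omit [StarRing E] in
/-- The inverse of `antidiag(1, u, 1)` is `antidiag(1, u⁻¹, 1)`. -/
theorem J3_inv (u : E) (hu : u ≠ 0) : (J3 u)⁻¹ = J3 u⁻¹ :=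
  Matrix.inv_eq_right_inv (J3_mul_J3_inv u hu)

end Diagonal

section Det

variable {R E : Type*} [CommRing R] [CommRing E] [Algebra R E]

/-- The determinant of a matrix with `R`-integral entries is `R`-integral. -/
theorem isInteger_det {n : Type*} [Fintype n] [DecidableEq n] {M : Matrix n n E}
    (hM : ∀ i j, IsLocalization.IsInteger R (M i j)) : IsLocalization.IsInteger R M.det := by
  simp only [IsLocalization.IsInteger, RingHom.mem_rangeS] at hM ⊢
  choose m hm using hM
  refine ⟨(Matrix.of m).det, ?_⟩
  rw [RingHom.map_det]
  congr 1
  ext i j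
  simp [hm]

end Det

section Core

variable {R₀ F E : Type*} [CommRing R₀] [IsDomain R₀] [IsIntegrallyClosed R₀] [Field F] [Field E]
  [Algebra R₀ F] [IsFractionRing R₀ F] [Algebra F E] [Algebra R₀ E] [IsScalarTower R₀ F E]
  [StarRing E]

omit [IsDomain R₀] [IsIntegrallyClosed R₀] [StarRing E] in
include F in
/-- `R₀ → E` is injective (through the fraction field `F`). -/
theorem algebraMap_injective' : Function.Injective (algebraMap R₀ E) := by
  rw [IsScalarTower.algebraMap_eq R₀ F E]
  exact (algebraMap F E).injective.comp (IsFractionRing.injective R₀ F)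

omit [IsDomain R₀] in
/-- A star-fixed element of `E` that is integral over `R₀` lies in `R₀` (`R₀` integrally closed,
the fixed field of the star being `F`). -/
theorem exists_algebraMap_eq_of_star_eq_of_isInteger
    (hF : ∀ z : E, star z = z → z ∈ Set.range (algebraMap F E)) {z : E} (hz : star z = z)
    (hint : IsLocalization.IsInteger (integralClosure R₀ E) z) : ∃ r : R₀, algebraMap R₀ E r = z := by
  obtain ⟨f, rfl⟩ := hF z hz
  have hzi : IsIntegral R₀ (algebraMap F E f) := by
    obtain ⟨⟨y, hy⟩, hyz⟩ := hint
    have : (y : E) = algebraMap F E f := hyz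
    rw [← this]
    exact hy
  obtain ⟨r, hr⟩ := IsIntegrallyClosed.isIntegral_iff.mp
    ((isIntegral_algebraMap_iff (algebraMap F E).injective).mp hzi)
  exact ⟨r, by rw [IsScalarTower.algebraMap_apply R₀ F E, hr]⟩

omit [IsDomain R₀] in
/-- A star-fixed element of `E` that is integral with integral inverse lies in `R₀ˣ`. -/
theorem exists_algebraMap_unit_eq_of_star_eq_of_isInteger
    (hF : ∀ z : E, star z = z → z ∈ Set.range (algebraMap F E)) {z : E} (hz : star z = z)
    (hz0 : z ≠ 0) (hint : IsLocalization.IsInteger (integralClosure R₀ E) z)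
    (hinv : IsLocalization.IsInteger (integralClosure R₀ E) z⁻¹) :
    ∃ r : R₀ˣ, algebraMap R₀ E r = z := by
  obtain ⟨r, hr⟩ := exists_algebraMap_eq_of_star_eq_of_isInteger hF hz hint
  obtain ⟨r', hr'⟩ := exists_algebraMap_eq_of_star_eq_of_isInteger hF
    (by rw [star_inv₀, hz]) hinv
  have hrr' : r * r' = 1 := by
    apply algebraMap_injective' (F := F) (E := E)
    rw [map_mul, hr, hr', mul_inv_cancel₀ hz0, map_one]
  exact ⟨Units.mkOfMulEqOne r r' hrr', hr⟩

omit [IsDomain R₀] [IsIntegrallyClosed R₀] in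
/-- **(⇐)** If `det H = a · N(y)` with `a ∈ R₀ˣ`, `y ∈ E^×`, then `H` is congruent over `E` to
`antidiag(1, u₁, 1)` with `u₁ ∈ R₀ˣ`: the field-level normal form `Pᴴ H P = antidiag(1, u, 1)`
scaled by `diag(1, (y · det P)⁻¹, 1)`. -/
theorem exists_congruent_J3_unit_of_det_eq_mul_norm
    {H : Matrix (Fin 3) (Fin 3) E} (hH : H.IsHermitian) (hdet : IsUnit H.det) (h2 : (2 : E) ≠ 0)
    {e : Fin 3 → E} (he : e ≠ 0) (he0 : sesqForm H e e = 0)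
    (a : R₀ˣ) {y : E} (hy : y ≠ 0) (hdetH : H.det = algebraMap R₀ E a * (star y * y)) :
    ∃ Q : Matrix (Fin 3) (Fin 3) E, IsUnit Q ∧
      ∃ u₁ : R₀ˣ, Q.conjTranspose * H * Q = J3 (algebraMap R₀ E u₁) := by
  obtain ⟨P, u, hP, -, -, -, hPHP⟩ :=
    exists_congruent_J3 hH ((Matrix.isUnit_iff_isUnit_det H).mpr hdet) h2 he he0
  have hPdet : P.det ≠ 0 := ((Matrix.isUnit_iff_isUnit_det P).mp hP).ne_zero
  have hdetPHP : star P.det * H.det * P.det = -u := by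
    have := congrArg Matrix.det hPHP
    rwa [det_J3, Matrix.det_mul, Matrix.det_mul, Matrix.det_conjTranspose] at this
  set d : E := (y * P.det)⁻¹ with hd
  have hd0 : d ≠ 0 := inv_ne_zero (mul_ne_zero hy hPdet)
  refine ⟨P * Matrix.diagonal ![1, d, 1], ?_, -a, ?_⟩
  · refine hP.mul ((Matrix.isUnit_iff_isUnit_det _).mpr ?_)
    rw [Matrix.det_diagonal, Fin.prod_univ_three]
    simpa using hd0
  · have key : (P * Matrix.diagonal ![1, d, 1]).conjTranspose * H * (P * Matrix.diagonal ![1, d, 1]) =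
        (Matrix.diagonal ![1, d, 1]).conjTranspose * (P.conjTranspose * H * P) *
          Matrix.diagonal ![1, d, 1] := by
      simp only [Matrix.conjTranspose_mul, Matrix.mul_assoc]
    rw [key, hPHP, conjTranspose_diagonal_mul_J3_mul_diagonal]
    congr 1
    rw [Units.val_neg, map_neg]
    have hsd : star d = (star y * star P.det)⁻¹ := by rw [hd, star_inv₀, star_mul, mul_comm]
    have hu' : u = -(star P.det * (algebraMap R₀ E a * (star y * y)) * P.det) := by
      rw [← hdetH, hdetPHP, neg_neg]
    have hsy : star y ≠ 0 := star_ne_zero.mpr hy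
    have hsP : star P.det ≠ 0 := star_ne_zero.mpr hPdet
    rw [hsd, hu', hd]
    field_simp

omit [IsDomain R₀] in
/-- **(⇒)** If `Qᴴ H Q` has integral entries and integral inverse for some `Q ∈ GL₃(E)` (the lattice
`Q · 𝒪_E³` is self-dual for `H`), then `det H = a · N(y)` with `a ∈ R₀ˣ` and `y = (det Q)⁻¹`. -/
theorem exists_det_eq_mul_norm_of_congruent_integral
    (hF : ∀ z : E, star z = z → z ∈ Set.range (algebraMap F E))
    {H : Matrix (Fin 3) (Fin 3) E} (hH : H.IsHermitian) (hdet : IsUnit H.det)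
    {Q : Matrix (Fin 3) (Fin 3) E} (hQ : IsUnit Q)
    (hG : ∀ i j, IsLocalization.IsInteger (integralClosure R₀ E) ((Q.conjTranspose * H * Q) i j))
    (hG' : ∀ i j, IsLocalization.IsInteger (integralClosure R₀ E)
      ((Q.conjTranspose * H * Q)⁻¹ i j)) :
    ∃ (a : R₀ˣ) (y : E), y ≠ 0 ∧ H.det = algebraMap R₀ E a * (star y * y) := by
  have hQdet : Q.det ≠ 0 := ((Matrix.isUnit_iff_isUnit_det Q).mp hQ).ne_zero
  have hGdet : (Q.conjTranspose * H * Q).det = star Q.det * H.det * Q.det := by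
    rw [Matrix.det_mul, Matrix.det_mul, Matrix.det_conjTranspose]
  have hGdet0 : (Q.conjTranspose * H * Q).det ≠ 0 := by
    rw [hGdet]
    exact mul_ne_zero (mul_ne_zero (star_ne_zero.mpr hQdet) hdet.ne_zero) hQdet
  have hGherm : (Q.conjTranspose * H * Q).IsHermitian := Matrix.isHermitian_conjTranspose_mul_mul Q hH
  have hstarDet : star (Q.conjTranspose * H * Q).det = (Q.conjTranspose * H * Q).det := by
    rw [← Matrix.det_conjTranspose, hGherm.eq]
  have hGint : IsLocalization.IsInteger (integralClosure R₀ E) (Q.conjTranspose * H * Q).det :=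
    isInteger_det hG
  have hGinvint : IsLocalization.IsInteger (integralClosure R₀ E)
      (Q.conjTranspose * H * Q).det⁻¹ := by
    rw [← Ring.inverse_eq_inv, ← Matrix.det_nonsing_inv]
    exact isInteger_det hG'
  obtain ⟨r, hr⟩ := exists_algebraMap_unit_eq_of_star_eq_of_isInteger hF hstarDet hGdet0 hGint hGinvint
  refine ⟨r, Q.det⁻¹, inv_ne_zero hQdet, ?_⟩
  rw [hr, hGdet, star_inv₀]
  have hsQ : star Q.det ≠ 0 := star_ne_zero.mpr hQdet
  field_simp

omit [IsIntegrallyClosed R₀] [StarRing E] in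
include F in
/-- `antidiag(1, u, 1)` with `u ∈ R₀ˣ` has integral entries and integral inverse. -/
theorem isInteger_J3_unit (u₁ : R₀ˣ) :
    (∀ i j, IsLocalization.IsInteger (integralClosure R₀ E) (J3 (algebraMap R₀ E u₁) i j)) ∧
      ∀ i j, IsLocalization.IsInteger (integralClosure R₀ E) ((J3 (algebraMap R₀ E u₁))⁻¹ i j) := by
  have hu0 : algebraMap R₀ E u₁ ≠ 0 := by
    rw [map_ne_zero_iff _ (algebraMap_injective' (F := F) (E := E))]
    exact u₁.ne_zero
  have hu : IsLocalization.IsInteger (integralClosure R₀ E) (algebraMap R₀ E u₁) :=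
    ⟨⟨algebraMap R₀ E u₁, Subalgebra.algebraMap_mem _ _⟩, rfl⟩
  have hu' : IsLocalization.IsInteger (integralClosure R₀ E) (algebraMap R₀ E u₁)⁻¹ := by
    rw [← map_units_inv]
    exact ⟨⟨algebraMap R₀ E (u₁⁻¹ : R₀ˣ), Subalgebra.algebraMap_mem _ _⟩, rfl⟩
  refine ⟨isInteger_J3 hu, ?_⟩
  rw [J3_inv _ hu0]
  exact isInteger_J3 hu'

/-- **The equivalence.** For `H` hermitian, invertible and isotropic in three variables over `E`,
a basis `Q` in which `H` has integral entries and integral inverse (a self-dual lattice) exists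
iff `det H` is a unit of `R₀` times a norm `star y · y`. -/
theorem exists_congruent_integral_iff_det_eq_mul_norm
    (hF : ∀ z : E, star z = z → z ∈ Set.range (algebraMap F E))
    {H : Matrix (Fin 3) (Fin 3) E} (hH : H.IsHermitian) (hdet : IsUnit H.det) (h2 : (2 : E) ≠ 0)
    {e : Fin 3 → E} (he : e ≠ 0) (he0 : sesqForm H e e = 0) :
    (∃ Q : Matrix (Fin 3) (Fin 3) E, IsUnit Q ∧
        (∀ i j, IsLocalization.IsInteger (integralClosure R₀ E) ((Q.conjTranspose * H * Q) i j)) ∧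
        ∀ i j, IsLocalization.IsInteger (integralClosure R₀ E) ((Q.conjTranspose * H * Q)⁻¹ i j)) ↔
      ∃ (a : R₀ˣ) (y : E), y ≠ 0 ∧ H.det = algebraMap R₀ E a * (star y * y) := by
  constructor
  · rintro ⟨Q, hQ, hG, hG'⟩
    exact exists_det_eq_mul_norm_of_congruent_integral hF hH hdet hQ hG hG'
  · rintro ⟨a, y, hy, hdetH⟩
    obtain ⟨Q, hQ, u₁, hQHQ⟩ :=
      exists_congruent_J3_unit_of_det_eq_mul_norm hH hdet h2 he he0 a hy hdetH
    refine ⟨Q, hQ, ?_, ?_⟩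
    · rw [hQHQ]; exact (isInteger_J3_unit (F := F) u₁).1
    · rw [hQHQ]; exact (isInteger_J3_unit (F := F) u₁).2

/-- **The equivalence, lattice form.** With the lattice `Q · 𝒪_E³` spelled as the standard lattice
for the Gram matrix `Qᴴ H Q` (`T5UnitaryGroupIsometry.dualLattice`): `V = (E³, H)` admits a
self-dual `𝒪_E`-lattice iff `det H ∈ R₀ˣ · N(E^×)`. -/
theorem exists_dualLattice_eq_iff_det_eq_mul_norm
    (hF : ∀ z : E, star z = z → z ∈ Set.range (algebraMap F E))
    (hstar : ∀ x : E, IsLocalization.IsInteger (integralClosure R₀ E) x →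
      IsLocalization.IsInteger (integralClosure R₀ E) (star x))
    {H : Matrix (Fin 3) (Fin 3) E} (hH : H.IsHermitian) (hdet : IsUnit H.det) (h2 : (2 : E) ≠ 0)
    {e : Fin 3 → E} (he : e ≠ 0) (he0 : sesqForm H e e = 0) :
    (∃ Q : Matrix (Fin 3) (Fin 3) E, IsUnit Q ∧
        dualLattice (integralClosure R₀ E) (Q.conjTranspose * H * Q)
          (stdLattice (integralClosure R₀ E)) = stdLattice (integralClosure R₀ E)) ↔
      ∃ (a : R₀ˣ) (y : E), y ≠ 0 ∧ H.det = algebraMap R₀ E a * (star y * y) := by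
  rw [← exists_congruent_integral_iff_det_eq_mul_norm hF hH hdet h2 he he0]
  constructor
  · rintro ⟨Q, hQ, hL⟩
    have hGdet : IsUnit (Q.conjTranspose * H * Q).det := by
      rw [Matrix.det_mul, Matrix.det_mul, Matrix.det_conjTranspose]
      exact (((Matrix.isUnit_iff_isUnit_det Q).mp hQ).star.mul hdet).mul
        ((Matrix.isUnit_iff_isUnit_det Q).mp hQ)
    exact ⟨Q, hQ, integral_of_dualLattice_stdLattice_eq hstar (Matrix.nonsing_inv_mul _ hGdet) hL⟩
  · rintro ⟨Q, hQ, hG, hG'⟩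
    have hGdet : IsUnit (Q.conjTranspose * H * Q).det := by
      rw [Matrix.det_mul, Matrix.det_mul, Matrix.det_conjTranspose]
      exact (((Matrix.isUnit_iff_isUnit_det Q).mp hQ).star.mul hdet).mul
        ((Matrix.isUnit_iff_isUnit_det Q).mp hQ)
    exact ⟨Q, hQ, dualLattice_stdLattice_eq_self hstar (Matrix.mul_nonsing_inv _ hGdet) hG hG'⟩

end Core

section Quadratic

variable {R₀ F E : Type*} [CommRing R₀] [IsDomain R₀] [IsIntegrallyClosed R₀] [Field F] [Field E]
  [Algebra R₀ F] [IsFractionRing R₀ F] [Algebra F E] [Algebra R₀ E] [IsScalarTower R₀ F E]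
  [FiniteDimensional F E]

/-- The equivalence for the Galois conjugation `σ` of a quadratic extension `E/F` as the star
(`T5StarOfInvolution.starRingOfQuadratic`): `V = (E³, H)` admits a self-dual `𝒪_E`-lattice iff
`det H ∈ R₀ˣ · N_{E/F}(E^×)`. -/
theorem exists_dualLattice_eq_iff_det_eq_mul_norm_quadratic
    (h2 : Module.finrank F E = 2) (σ : E ≃ₐ[F] E) (hσ : σ ≠ 1)
    {H : Matrix (Fin 3) (Fin 3) E}
    (hH : letI := T5StarOfInvolution.starRingOfQuadratic h2 σ hσ; H.IsHermitian)
    (hdet : IsUnit H.det) (htwo : (2 : E) ≠ 0) {e : Fin 3 → E} (he : e ≠ 0)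
    (he0 : letI := T5StarOfInvolution.starRingOfQuadratic h2 σ hσ; sesqForm H e e = 0) :
    letI := T5StarOfInvolution.starRingOfQuadratic h2 σ hσ
    (∃ Q : Matrix (Fin 3) (Fin 3) E, IsUnit Q ∧
        dualLattice (integralClosure R₀ E) (Q.conjTranspose * H * Q)
          (stdLattice (integralClosure R₀ E)) = stdLattice (integralClosure R₀ E)) ↔
      ∃ (a : R₀ˣ) (y : E), y ≠ 0 ∧ H.det = algebraMap R₀ E a * (σ y * y) := by
  letI := T5StarOfInvolution.starRingOfQuadratic h2 σ hσ
  have hτ := T5QuadraticAutomorphism.apply_apply h2 σ hσ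
  have hstar_eq : ∀ y : E, star y = σ y := fun y =>
    T5StarOfInvolution.star_eq σ.toRingEquiv hτ y
  simp only [← hstar_eq]
  exact exists_dualLattice_eq_iff_det_eq_mul_norm
    (fun z hz => (T5StarOfInvolution.star_eq_self_iff_mem_range h2 σ hσ z).mp hz)
    (T5StarOfInvolution.isInteger_integralClosure_star σ hτ) hH hdet htwo he he0

end Quadratic

end Summit.Ventures.HodgeRepro2.T5SelfDualLatticeDet
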